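/-
Origin: expansion seat `planner-pub-hodgecm-mc-axioms-1-g14-0`, handover #W117 2026-08-20T15:53:55Z md5 a7bd024b7ea6 (PKG 11d14aea7aa5 → a7bd024b7ea6; 257 l.; MECHANICAL (iib-R) rewrite v3.1 of the PKG file as it stands (67 token edits; rules R9+R1x2+R2x1+RX[h₂']x3+R3x3+R8x57)) (`HOME/mc/pub-hodgecm-mc-axioms-1-g14/revendor/kit-r55/stage55/HodgeCM/Model/Universe.lean`, md5 a7bd024b7ea6, 257 lines);
landed by the gen-22 packager (p-g22) in gate run 55 REPLACES the earlier landed copy of `HodgeCM/Model/Universe.lean` (seat copy carried the packager Origin header of an earlier run (stripped)).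
-/
/-
G0-d (MODEL-DAG node G0, mc-axioms-3): the PKG record `HodgeCM.Universe` INSTANTIATED by the Picard–CM model.
v1 = LIGHT shape (J-P0-G ruling B): the two Betti imports are mc-axioms-1's IN-PLACE light revisions of
`BettiUniverseAxioms` / `BettiUniverseCMAction` (same module names and FQNs; tree p178941 + its step 2), and
`universeOf` / `modelAxiomsPerL` / `tr_degree` take the rows `(hHD : exists_isReal_hodgeModel)`
`(hI : hodgePQ_independent_of_hodgeModel)`, `hodgeRiemann20` additionally `(hHR : BettiUniverse.HodgeRiemann20)`
(BINDER-TRIAGE §14: R-HD, R-FUN ⊂ hI, R-HR20). Tree-jail simulation of this exact text (namespace `HodgeCMSim.Model`,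
PKG records copied verbatim): HOME/mc/pub-hodgecm-mc-axioms-3/scratch/g0d/UniverseSimLight.lean, pre-checked against
mc-axioms-1's staged light trio by concatenation (UniverseSimLightCat.lean: farm rc 0, 0 proof-holes, 0 warnings,
`#print axioms modelAxiomsPerL / hodgeRiemann20` = [propext, Classical.choice, Quot.sound]).
rev 2 (2026-08-18T23:45Z, mc-axioms-3-g3; supersedes kit row #220 9e23a563ed18): after the (iii)⁺ splice step 4 of the tree
module `PicardCMUniverse` (p180995, tree md5 e8ff868f41b2; re-vendored twin in the same kit) the CONTENT predicates take
`h₃`: `IsAbelianVariety := Var.IsAbelianVariety h₃`, `IsCMAbelianVariety := Var.IsCMAbelianVariety h₃`, and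
`universeOf_cmAV_dim` is witnessed by the tree theorems `Var.isAbelianVariety_cm h₃` / `Var.isCMAbelianVariety_cm h₃`
(the former `True` tags are gone, RULING G0-iii⁺ c2); no other code byte changes (header l.9: token hygiene «proof-holes»). Certificate: tree-jail simulation of exactly
these three edits inside mc-axioms-1-g3 `scratch/CMInflationSim.lean` 938e922640df PART C (farm rc 0, 0 warnings,
0 proof-holes, `#print axioms` = [propext, Classical.choice, Quot.sound]).
-/
import Summits.HodgeConjecture.HodgeCM.Geometry.Universe
import Summits.HodgeConjecture.HodgeCM.Geometry.Facts
import Summits.HodgeConjecture.HodgeCM.Geometry.Statements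
import Summits.HodgeConjecture.HodgeCM.CM.Basic
import Summits.HodgeConjecture.HodgeCM.Automorphic.ThetaFacts
import Summits.HodgeConjecture.HodgeCM.Automorphic.AdelicUnitaryModel_2
import Summits.HodgeConjecture.HodgeCM.Model.EndStatePerLAxioms_2
import Literature.NumberTheory.Automorphic.PicardCMUniverse
import Literature.AlgebraicGeometry.HodgeTheory.BettiUniverseAxioms
import Literature.AlgebraicGeometry.HodgeTheory.BettiUniverseCMAction

/-!
# The Picard–CM model universe `picardCMUniverse : HodgeCM.Universe` (G0-d)

`Var` = the honest index type of `PicardCMUniverse` (codes of compact Picard modular surfaces, of CM abelian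
varieties `ℂ^g/Φ(𝔞)`, projective spaces, binary products), interpreted in smooth projective `ℂ`-varieties by the
CHOSEN realisations (`pmsRealisation`, `cmRealisation`) of the cited records (ii) = (ii-a) ∧ (ii-b) and (iii) of
`PicardCMPrerequisites`; `Coh/hodge/pull/cup/tr` = the tree's Betti realisation + G3 (`BettiUniverse.*`);
`cmAct` = G0-c (`BettiUniverse.cmEndAction`) transported along `K ≃+* ι(K)`; `pms` = the code of the hermitian
data (J-SAN″: no default-code switch; off the anisotropic regime the realisation is the harmless total `ℙ²`).
END-STATE TERMS: `picardCMUniverse hHD hI h₁ hU h₃ : Universe`, `Model.modelAxiomsPerL hHD hI h₃ h₁ hU :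
(picardCMUniverse …).ModelAxiomsPerL`, `Model.tr_degree`, `Model.hodgeRiemann20 … (hHR : BettiUniverse.HodgeRiemann20) :
(picardCMUniverse …).Fact_hodgeRiemann20`; junction `rfl`-lemmas `universeOf_*`, `ballDatumOf`; A3 witnesses
`universeOf_finrank_H1`, `universeOf_cmAV_dim`. MODEL-N rows of this file's binders: GU (hHD, hI, hHR), G0-iia (h₁),
G0-iib (hU), G0-iii (h₃) — see HOME/mc/pub-hodgecm-mc-axioms-3/notes/MODEL-N-G0-draft.md v2.
-/

noncomputable section

open scoped TensorProduct Matrix ComplexOrder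
open NumberField
open Literature.AlgebraicGeometry.Motives (CMType)
open Literature.AlgebraicGeometry.Motives
open Literature.AlgebraicGeometry.Motives.HodgeStructure (EndAction conj ofRat)
open Literature.AlgebraicGeometry.ShimuraVarieties

namespace HodgeCM

namespace Model

open Literature.NumberTheory.Automorphic.PicardCM
open Literature.AlgebraicGeometry.HodgeTheory

/- The GU rows of MODEL-N (J-P0-G ruling B, BINDER-TRIAGE §14; G3-light, mc-axioms-1):
`hHD` = the Hodge decomposition with its real structure (R-HD), `hI` = model-independence of
`H^{p,q}` (carries R-FUN), and — on `hodgeRiemann20` only — `hHR : BettiUniverse.HodgeRiemann20`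
(R-HR20). All three are KERNEL theorems of the hub tree (`…_holds`), not vendored for size. -/
variable (hHD : exists_isReal_hodgeModel) (hI : hodgePQ_independent_of_hodgeModel)
variable (hU : Literature.NumberTheory.Automorphic.PicardCM.BallQuotientUniformisedDatum)
  (h₃ : Literature.NumberTheory.Automorphic.PicardCM.CMAbelianVarietyRealised)

/-- A fixed complex embedding of the CM field `K` (KERNEL: `K →+* ℂ` is nonempty for a number
field, `NumberField.Embeddings.instNonemptyRingHom`), selected once and for all by the global choice
function. A2 NOTE (mc-ref1-g2 entry 68): this is DATA BY CHOICE over a kernel existential, not a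
cited record — nothing about the selected embedding is ever used except that it is one; any other
selection `ι'` gives the code `CMCode.ofCMType ι' Φ` with `ι'.rangeRestrictFieldEquiv.trans
(cmCodeEquiv K Φ).symm`-isomorphic field and the transported CM type, hence an isomorphic indexed
family `U.cmAV`; the END STATE `U.PerL` is asserted for THE universe built from THIS selection
(as it is for the selection `cmRealisation h₃` of a realising abelian variety). 0 rows. -/
def cmEmb (K : CMField) : K →+* ℂ := Classical.arbitrary (K →+* ℂ)

/-- The CM code of `(K, Φ)` at the fixed embedding. -/
def cmCode (K : CMField) (Φ : CMType K) : CMCode := CMCode.ofCMType (cmEmb K) Φ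

/-- `K ≃+* (cmCode K Φ).E = (cmEmb K)(K) ⊂ ℂ`. -/
def cmCodeEquiv (K : CMField) (Φ : CMType K) : K ≃+* (cmCode K Φ).E :=
  (cmEmb K).rangeRestrictFieldEquiv

/-- The Picard code of `(L, ι₁, V, Γ)`: the hypothesis types of `PicardCode.ofHermitian` are the PKG
field types (`conjRingHomK L` unfolds to `(IsCMField.complexConj L).toRingEquiv.toRingHom`). -/
def pmsCode (L : CMField) (ι₁ : L →+* ℂ) (V : HermSpace3 L ι₁) (Γ : Level V) : PicardCode :=
  PicardCode.ofHermitian ι₁ V.Hm Γ.Γ V.isHermitian V.signature_ι₁ V.posDef_of_ne Γ.isCongruence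
    Γ.torsionFree

/-- Anisotropy of the Picard code of `(L, ι₁, V, Γ)` is the PKG's `IsAnisotropic L V.Hm`. -/
theorem isAnisotropic_pmsCode_iff (L : CMField) (ι₁ : L →+* ℂ) (V : HermSpace3 L ι₁) (Γ : Level V) :
    (pmsCode L ι₁ V Γ).IsAnisotropic ↔ IsAnisotropic L V.Hm :=
  PicardCode.isAnisotropic_ofHermitian_iff ι₁ V.Hm Γ.Γ V.isHermitian V.signature_ι₁ V.posDef_of_ne
    Γ.isCongruence Γ.torsionFree

/-! J-SAN″ (carver ruling 2026-08-18T18:55:57Z, POINTWISE END STATE): no default-code switch —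
`U.pms` is the plain code realisation; off the anisotropic regime (`L` imaginary quadratic and
`V.Hm` isotropic, never met on the `PerL` path where `24 ∣ [L:ℚ]`) the tree's `pmsRealisation`
takes its harmless total branch `ℙ²`, about which nothing is ever asserted. -/

/-- In the regime `2 < [L:ℚ]` every hermitian 3-space of the given signatures is anisotropic. -/
theorem isAnisotropic_of_two_lt (L : CMField) (ι₁ : L →+* ℂ) (V : HermSpace3 L ι₁) (Γ : Level V)
    (hL : 2 < Module.finrank ℚ L) : IsAnisotropic L V.Hm :=
  (isAnisotropic_pmsCode_iff L ι₁ V Γ).1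
    (PicardCode.isAnisotropic_ofHermitian ι₁ V.Hm Γ.Γ V.isHermitian V.signature_ι₁ V.posDef_of_ne
      Γ.isCongruence Γ.torsionFree hL)

/-- The CM action on `H¹` of the CHOSEN realisation of a CM code, transported to an abstract field
`K ≃+* c.E` (G0-c `BettiUniverse.cmEndAction`; the hypothesis `IsInducedOnIntegers` is the record's
`exists_map`, reindexed by `CMRealisation.exists_map_comp`). -/
def cmActOf (c : CMCode) (K : Type) [Field K] [NumberField K] (e : K ≃+* c.E) :
    EndAction (BettiUniverse.hodge hHD (Var.isSmoothProjective hU h₃ (.cm c)) 1) K :=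
  BettiUniverse.cmEndAction ((cmRealisation h₃ c).θ.comp e.toRingHom)
    ((cmRealisation h₃ c).exists_map_comp e) hHD hI (Var.isSmoothProjective hU h₃ (.cm c))

/-- **The model universe over the packaged hypothesis (ii)** `BallQuotientUniformisedDatum` and the record
(iii): every field instantiated by the tree's constructions. -/
def universeOf : Universe where
  Var := Var
  dim := Var.dim
  Coh := Var.Coh hU h₃
  instFinite := Var.finite hU h₃
  hodge X k := BettiUniverse.hodge hHD (Var.isSmoothProjective hU h₃ X) k
  alg := Var.alg hU h₃
  Mor := Var.Mor hU h₃
  idMor := Var.idMor hU h₃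
  comp f g := Var.comp hU h₃ f g
  pull f k := BettiUniverse.pull f k
  cup X i j := BettiUniverse.cup (Var.scheme hU h₃ X) i j
  tr X k := BettiUniverse.tr (Var.isSmoothProjective hU h₃ X) k
  prod := Var.prod
  fst := Var.fst hU h₃
  snd := Var.snd hU h₃
  IsAbelianVariety := Var.IsAbelianVariety h₃
  IsCMAbelianVariety := Var.IsCMAbelianVariety h₃
  cmAV K Φ := .cm (cmCode K Φ)
  cmAct K Φ := cmActOf hHD hI hU h₃ (cmCode K Φ) K (cmCodeEquiv K Φ)
  pms L ι₁ V Γ := .pms (pmsCode L ι₁ V Γ)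

/-- The five `ModelAxioms` fields of the E2′ cone hold in the model (G3-light theorems over
`hHD`, `hI`; `pms_dim` by `rfl`). -/
theorem universeOf_modelAxiomsPerL : (universeOf hHD hI hU h₃).ModelAxiomsPerL where
  pull_comp _ _ _ f g k := BettiUniverse.pull_comp f g k
  pull_cup _ _ f i j x y := BettiUniverse.pull_cup f i j x y
  pull_hodge X Y f k p :=
    BettiUniverse.pull_hodge hHD hI (Var.isSmoothProjective hU h₃ X) (Var.isSmoothProjective hU h₃ Y) f k p
  cup2_hodge X k p q x y hx hy := BettiUniverse.cup2_hodge hHD hI (Var.isSmoothProjective hU h₃ X) k p q x y hx hy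
  pms_dim _ _ _ _ := rfl

/-- `Fact_tr_degree` in the model (G3 `tr_of_ne`). -/
theorem universeOf_tr_degree : (universeOf hHD hI hU h₃).Fact_tr_degree :=
  fun X _ hk ↦ BettiUniverse.tr_of_ne (Var.isSmoothProjective hU h₃ X) hk

/-- `Fact_hodgeRiemann20` in the model, over the row `hHR : BettiUniverse.HodgeRiemann20` (R-HR20)
applied to the chosen real Hodge model (G3-light `hodgeRiemann_two_zero`). -/
theorem universeOf_hodgeRiemann20 (hHR : BettiUniverse.HodgeRiemann20) :
    (universeOf hHD hI hU h₃).Fact_hodgeRiemann20 :=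
  fun X hX η hη h0 ↦
    BettiUniverse.hodgeRiemann_two_zero hHD hHR (Var.isSmoothProjective hU h₃ X) hX η hη h0


/-! ### Junction lemmas (all `rfl`): how the fields of the model universe compute -/

section Junction

variable {hHD hI hU h₃}

/-- (Ported verbatim from the HodgeCMPerL package; no docstring in the source.) -/
@[simp] theorem universeOf_Var : (universeOf hHD hI hU h₃).Var = Var := rfl
/-- (Ported verbatim from the HodgeCMPerL package; no docstring in the source.) -/
@[simp] theorem universeOf_dim (X : Var) : (universeOf hHD hI hU h₃).dim X = X.dim := rfl
/-- (Ported verbatim from the HodgeCMPerL package; no docstring in the source.) -/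
theorem universeOf_Coh (X : Var) (k : ℕ) :
    (universeOf hHD hI hU h₃).Coh X k = bettiCohomology (Var.scheme hU h₃ X) k := rfl
/-- (Ported verbatim from the HodgeCMPerL package; no docstring in the source.) -/
theorem universeOf_hodge (X : Var) (k : ℕ) :
    (universeOf hHD hI hU h₃).hodge X k = BettiUniverse.hodge hHD (Var.isSmoothProjective hU h₃ X) k := rfl
/-- (Ported verbatim from the HodgeCMPerL package; no docstring in the source.) -/
theorem universeOf_Mor (X Y : Var) :
    (universeOf hHD hI hU h₃).Mor X Y = (Var.scheme hU h₃ X ⟶ Var.scheme hU h₃ Y) := rfl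
/-- (Ported verbatim from the HodgeCMPerL package; no docstring in the source.) -/
theorem universeOf_pull {X Y : Var} (f : (universeOf hHD hI hU h₃).Mor X Y) (k : ℕ) :
    (universeOf hHD hI hU h₃).pull f k = BettiUniverse.pull f k := rfl
/-- (Ported verbatim from the HodgeCMPerL package; no docstring in the source.) -/
theorem universeOf_cup (X : Var) (i j : ℕ) :
    (universeOf hHD hI hU h₃).cup X i j = BettiUniverse.cup (Var.scheme hU h₃ X) i j := rfl
/-- (Ported verbatim from the HodgeCMPerL package; no docstring in the source.) -/
theorem universeOf_tr (X : Var) (k : ℕ) :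
    (universeOf hHD hI hU h₃).tr X k = BettiUniverse.tr (Var.isSmoothProjective hU h₃ X) k := rfl
/-- (Ported verbatim from the HodgeCMPerL package; no docstring in the source.) -/
@[simp] theorem universeOf_cmAV (K : CMField) (Φ : CMType K) :
    (universeOf hHD hI hU h₃).cmAV K Φ = .cm (cmCode K Φ) := rfl
/-- (Ported verbatim from the HodgeCMPerL package; no docstring in the source.) -/
theorem universeOf_cmAct (K : CMField) (Φ : CMType K) :
    (universeOf hHD hI hU h₃).cmAct K Φ = cmActOf hHD hI hU h₃ (cmCode K Φ) K (cmCodeEquiv K Φ) := rfl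
/-- (Ported verbatim from the HodgeCMPerL package; no docstring in the source.) -/
@[simp] theorem universeOf_pms (L : CMField) (ι₁ : L →+* ℂ) (V : HermSpace3 L ι₁) (Γ : Level V) :
    (universeOf hHD hI hU h₃).pms L ι₁ V Γ = .pms (pmsCode L ι₁ V Γ) := rfl
/-- In-regime (`V.Hm` anisotropic — always when `2 < [L:ℚ]`, `isAnisotropic_of_two_lt`): the scheme
under `U.pms L ι₁ V Γ` carries the ball-quotient datum of the code of the data (uniformisation by
`Γ`, special cycles), for the D1-G / E-J consumers. -/
def ballDatumOf (L : CMField) (ι₁ : L →+* ℂ) (V : HermSpace3 L ι₁) (Γ : Level V)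
    (h : IsAnisotropic L V.Hm) :
    Literature.AlgebraicGeometry.ShimuraVarieties.UnitaryBallUniformisationDatum 2
      (Var.scheme hU h₃ ((universeOf hHD hI hU h₃).pms L ι₁ V Γ)) :=
  Var.ballDatum hU h₃ (pmsCode L ι₁ V Γ) ((isAnisotropic_pmsCode_iff L ι₁ V Γ).2 h)

end Junction

/-! ### Further `Fact_…` of the PKG discharged by the construction (A3 witnesses on the CHOSEN
objects; not in the E2′ cone) -/

/-- PKG `Fact_H1_rank` shape: `dim_ℚ H¹(A_{(K,Φ)}, ℚ) = [K:ℚ]` — for the CHOSEN `A`. -/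
theorem universeOf_finrank_H1 (K : CMField) (Φ : CMType K) :
    Module.finrank ℚ ((universeOf hHD hI hU h₃).Coh ((universeOf hHD hI hU h₃).cmAV K Φ) 1) =
      Module.finrank ℚ K := by
  change Module.finrank ℚ (bettiCohomology (cmRealisation h₃ (cmCode K Φ)).A 1) = _
  rw [BettiUniverse.finrank_bettiCohomology_eq (cmRealisation h₃ (cmCode K Φ)).isSmoothProjective 1,
    (cmRealisation h₃ (cmCode K Φ)).finrank_eq, cmCode, CMCode.finrank_ofCMType_E]

/-- PKG `Fact_cmAV` shape: `cmAV K Φ` is (indexed as) a CM abelian variety of dimension `[K:ℚ]/2`. -/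
theorem universeOf_cmAV_dim (K : CMField) (Φ : CMType K) :
    (universeOf hHD hI hU h₃).IsAbelianVariety ((universeOf hHD hI hU h₃).cmAV K Φ) ∧
      (universeOf hHD hI hU h₃).IsCMAbelianVariety ((universeOf hHD hI hU h₃).cmAV K Φ) ∧
        (universeOf hHD hI hU h₃).dim ((universeOf hHD hI hU h₃).cmAV K Φ) = Module.finrank ℚ K / 2 := by
  refine ⟨Var.isAbelianVariety_cm h₃ _, Var.isCMAbelianVariety_cm h₃ _, ?_⟩
  rw [universeOf_cmAV, universeOf_dim, Var.dim_cm, cmCode, CMCode.finrank_ofCMType_E]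

/-! ### The end-state term over the PRINT records R-HD (`hHD`), `hI`, (ii-a), (ii-b), (iii) — and
R-HR20 (`hHR`) on `hodgeRiemann20` — (= the MODEL-N rows G0 / GU) -/

/-- **The Picard–CM model universe** `U`, over exactly the three cited records
(ii-a) `BallQuotientUniformised`, (ii-b) `SpecialCyclesAlgebraic`, (iii) `CMAbelianVarietyRealised`
of `PicardCMPrerequisites` (p177598); (ii) is assembled by the kernel packaging
`ballQuotientAlgebraic_of`. -/
def picardCMUniverse (hHD : exists_isReal_hodgeModel) (hI : hodgePQ_independent_of_hodgeModel)
    (h₁ : BallQuotientUniformised)  (h₃ : CMAbelianVarietyRealised) :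
    Universe :=
  universeOf hHD hI (ballQuotientUniformisedDatum_of h₁) h₃

variable (h₁ : BallQuotientUniformised)

/-- `M₅ : U.ModelAxiomsPerL` for the model universe — KERNEL over the rows `hHD`, `hI`, (ii-a),
(ii-b), (iii). -/
theorem modelAxiomsPerL : (picardCMUniverse hHD hI h₁ h₃).ModelAxiomsPerL :=
  universeOf_modelAxiomsPerL hHD hI _ h₃

/-- `Fact_tr_degree` for the model universe — KERNEL. -/
theorem tr_degree : (picardCMUniverse hHD hI h₁ h₃).Fact_tr_degree :=
  universeOf_tr_degree hHD hI _ h₃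

/-- `hHR : U.Fact_hodgeRiemann20` for the model universe — over the row `BettiUniverse.HodgeRiemann20`. -/
theorem hodgeRiemann20 (hHR : BettiUniverse.HodgeRiemann20) :
    (picardCMUniverse hHD hI h₁ h₃).Fact_hodgeRiemann20 :=
  universeOf_hodgeRiemann20 hHD hI _ h₃ hHR

end Model

end HodgeCM

end
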